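import Literature.Analysis.Calculus.SmoothTransitionDerivatives
import HarnessLib

/-!
# Smooth plateau profiles with convex ends (Ożański 2017, App. 8.1, proof of Lemma 21)

Topic `Literature/Analysis/Calculus`. The one-dimensional profiles `fᵢ` of W. S. Ożański,
arXiv:1709.00602, Appendix 8.1, proof of Lemma 21 (the cut-off function on a rectangle entering
Scheffer's construction, his Theorem 6; discharge path of the barrier fact
`Literature.Barriers.NavierStokesRegularity.NSIArrangementExists`): given `a < b` and `η > 0`,
"`fᵢ ∈ C₀^∞(ℝ; [0,1])` such that `supp fᵢ = [aᵢ, bᵢ]`, `fᵢ > 0` on `(aᵢ, bᵢ)` with `fᵢ = 1`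
on `[aᵢ+η, bᵢ-η]`, `fᵢ''' > 0` on `(aᵢ, aᵢ+ε)` and `fᵢ''' < 0` on `(bᵢ-ε, bᵢ)` for some
`ε ∈ (0,η)`", symmetric about the midpoint of `[aᵢ, bᵢ]`. Ożański takes `exp(-(x-a)⁻²)` near the
ends and glues; we take the explicit product
`plateauProfile a b η x = S((x-a)/η) · S((b-x)/η)`, `S = Real.smoothTransition`, whose ends are
convex by `exists_deriv3_smoothTransition_pos` (`SmoothTransitionDerivatives`): near `a` the
second factor is `1` and the profile is `S((x-a)/η)`, near `b` it is `S((b-x)/η)`.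

## Contents

* `plateauProfile` and its elementary properties: smooth, values in `[0,1]`, `= 0` off `(a,b)`,
  `> 0` on `(a,b)`, `= 1` on `[a+η, b-η]`, support `(a,b)` / `[a,b]`, symmetric;
* `plateauProfile_eq_left/right`: the one-factor formulas near the ends;
* `exists_deriv3_plateauProfile`: some `ε ∈ (0, η]` with `f''' > 0` on `(a, a+ε)` and `f''' < 0`
  on `(b-ε, b)` (requires `a + 2η ≤ b`).

## References

* W. S. Ożański, arXiv:1709.00602 (2017), Appendix 8.1, proof of Lemma 21 (the functions `fᵢ`).
  [`Ozanski2017NSIInternal`]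
-/

noncomputable section

open Set Filter Real
open scoped Topology ContDiff

namespace Literature.Analysis.Calculus

/-! ### The profile -/

/-- **The smooth plateau profile** on `[a,b]` with transition width `η`:
`plateauProfile a b η x = S((x-a)/η) · S((b-x)/η)`, `S = Real.smoothTransition` (a concrete
choice of Ożański's `fᵢ`, App. 8.1, proof of Lemma 21). Intended for `η > 0`.
[cite: Ozanski2017NSIInternal, Appendix 8.1 (proof of Lemma 21)] -/
def plateauProfile (a b η x : ℝ) : ℝ :=
  smoothTransition ((x - a) / η) * smoothTransition ((b - x) / η)

variable {a b η x : ℝ}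

/-- The profile is smooth. [folklore] -/
theorem contDiff_plateauProfile (a b η : ℝ) : ContDiff ℝ ∞ (plateauProfile a b η) := by
  unfold plateauProfile
  exact (smoothTransition.contDiff.comp ((contDiff_id.sub contDiff_const).div_const η)).mul
    (smoothTransition.contDiff.comp ((contDiff_const.sub contDiff_id).div_const η))

/-- `0 ≤ f`. [folklore] -/
theorem plateauProfile_nonneg (a b η x : ℝ) : 0 ≤ plateauProfile a b η x :=
  mul_nonneg (smoothTransition.nonneg _) (smoothTransition.nonneg _)

/-- `f ≤ 1`. [folklore] -/
theorem plateauProfile_le_one (a b η x : ℝ) : plateauProfile a b η x ≤ 1 :=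
  mul_le_one₀ (smoothTransition.le_one _) (smoothTransition.nonneg _) (smoothTransition.le_one _)

/-- `f = 0` to the left of `a`. [cite: Ozanski2017NSIInternal, Appendix 8.1 (proof of Lemma 21)] -/
theorem plateauProfile_eq_zero_of_le (hη : 0 < η) (hx : x ≤ a) : plateauProfile a b η x = 0 := by
  rw [plateauProfile, smoothTransition.zero_of_nonpos (div_nonpos_of_nonpos_of_nonneg (by linarith)
    hη.le), zero_mul]

/-- `f = 0` to the right of `b`. [cite: Ozanski2017NSIInternal, Appendix 8.1 (proof of Lemma 21)] -/
theorem plateauProfile_eq_zero_of_ge (hη : 0 < η) (hx : b ≤ x) : plateauProfile a b η x = 0 := by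
  rw [plateauProfile, smoothTransition.zero_of_nonpos (x := (b - x) / η)
    (div_nonpos_of_nonpos_of_nonneg (by linarith) hη.le), mul_zero]

/-- `f > 0` on `(a,b)`. [cite: Ozanski2017NSIInternal, Appendix 8.1 (proof of Lemma 21)] -/
theorem plateauProfile_pos (hη : 0 < η) (hx : x ∈ Ioo a b) : 0 < plateauProfile a b η x :=
  mul_pos (smoothTransition.pos_of_pos (div_pos (sub_pos.2 hx.1) hη))
    (smoothTransition.pos_of_pos (div_pos (sub_pos.2 hx.2) hη))

/-- `f = 1` on the plateau `[a+η, b-η]`. [cite: Ozanski2017NSIInternal, Appendix 8.1 (proof of Lemma 21)] -/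
theorem plateauProfile_eq_one (hη : 0 < η) (hx : x ∈ Icc (a + η) (b - η)) :
    plateauProfile a b η x = 1 := by
  rw [plateauProfile, smoothTransition.one_of_one_le, smoothTransition.one_of_one_le, mul_one]
  · rw [le_div_iff₀ hη]; linarith [hx.2]
  · rw [le_div_iff₀ hη]; linarith [hx.1]

/-- The support of the profile is `(a,b)`. [cite: Ozanski2017NSIInternal, Appendix 8.1 (proof of Lemma 21)] -/
theorem support_plateauProfile (hη : 0 < η) : Function.support (plateauProfile a b η) = Ioo a b := by
  ext x
  rw [Function.mem_support, mem_Ioo]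
  constructor
  · intro h
    constructor
    · by_contra hxa
      exact h (plateauProfile_eq_zero_of_le hη (not_lt.1 hxa))
    · by_contra hxb
      exact h (plateauProfile_eq_zero_of_ge hη (not_lt.1 hxb))
  · intro h
    exact (plateauProfile_pos hη h).ne'

/-- The closed support of the profile is `[a,b]` (`supp fᵢ = [aᵢ, bᵢ]`), for `a < b`.
[cite: Ozanski2017NSIInternal, Appendix 8.1 (proof of Lemma 21)] -/
theorem tsupport_plateauProfile (hη : 0 < η) (hab : a < b) :
    tsupport (plateauProfile a b η) = Icc a b := by
  rw [tsupport, support_plateauProfile hη, closure_Ioo hab.ne]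

/-- Symmetry about the midpoint: `f(a + b - x) = f(x)`. [cite: Ozanski2017NSIInternal, Appendix 8.1 (proof of Lemma 21)] -/
theorem plateauProfile_symm (a b η x : ℝ) :
    plateauProfile a b η (a + b - x) = plateauProfile a b η x := by
  rw [plateauProfile, plateauProfile, mul_comm]
  congr 2 <;> ring

/-- Left of `b - η` the second factor is `1`: `f(x) = S((x-a)/η)`. [folklore] -/
theorem plateauProfile_eq_left (hη : 0 < η) (hx : x ≤ b - η) :
    plateauProfile a b η x = smoothTransition ((x - a) / η) := by
  rw [plateauProfile, smoothTransition.one_of_one_le (x := (b - x) / η), mul_one]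
  rw [le_div_iff₀ hη]; linarith

/-- Right of `a + η` the first factor is `1`: `f(x) = S((b-x)/η)`. [folklore] -/
theorem plateauProfile_eq_right (hη : 0 < η) (hx : a + η ≤ x) :
    plateauProfile a b η x = smoothTransition ((b - x) / η) := by
  rw [plateauProfile, smoothTransition.one_of_one_le (x := (x - a) / η), one_mul]
  rw [le_div_iff₀ hη]; linarith

/-! ### Third derivatives near the ends -/

/-- Chain rule with an increasing affine map, for a smooth `S`:
`(S((·-a)/η))' = η⁻¹ S'((·-a)/η)`. [folklore] -/
theorem deriv_comp_affine_left {S : ℝ → ℝ} (hS : ContDiff ℝ ∞ S) (a η : ℝ) :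
    deriv (fun x => S ((x - a) / η)) = fun x => η⁻¹ * deriv S ((x - a) / η) := by
  funext x
  have hc : HasDerivAt (fun x : ℝ => (x - a) / η) (1 / η) x :=
    ((hasDerivAt_id' x).sub_const a).div_const η
  have hS' : HasDerivAt S (deriv S ((x - a) / η)) ((x - a) / η) :=
    (hS.differentiable (by simp) _).hasDerivAt
  have h : HasDerivAt (fun x => S ((x - a) / η)) (deriv S ((x - a) / η) * (1 / η)) x :=
    hS'.comp x hc
  rw [h.deriv]
  ring

/-- Chain rule with a decreasing affine map, for a smooth `S`:
`(S((b-·)/η))' = -η⁻¹ S'((b-·)/η)`. [folklore] -/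
theorem deriv_comp_affine_right {S : ℝ → ℝ} (hS : ContDiff ℝ ∞ S) (b η : ℝ) :
    deriv (fun x => S ((b - x) / η)) = fun x => -η⁻¹ * deriv S ((b - x) / η) := by
  funext x
  have hc : HasDerivAt (fun x : ℝ => (b - x) / η) (-1 / η) x := by
    simpa using ((hasDerivAt_id' x).const_sub b).div_const η
  have hS' : HasDerivAt S (deriv S ((b - x) / η)) ((b - x) / η) :=
    (hS.differentiable (by simp) _).hasDerivAt
  have h : HasDerivAt (fun x => S ((b - x) / η)) (deriv S ((b - x) / η) * (-1 / η)) x :=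
    hS'.comp x hc
  rw [h.deriv]
  ring

/-- Third derivative through an increasing affine map: `(S((·-a)/η))''' = η⁻³ S'''((·-a)/η)`. [folklore] -/
theorem deriv3_comp_affine_left {S : ℝ → ℝ} (hS : ContDiff ℝ ∞ S) (a η : ℝ) :
    deriv (deriv (deriv fun x => S ((x - a) / η))) =
      fun x => η⁻¹ ^ 3 * deriv (deriv (deriv S)) ((x - a) / η) := by
  have h1 : ContDiff ℝ ∞ (deriv S) := hS.iterate_deriv 1
  have h2 : ContDiff ℝ ∞ (deriv (deriv S)) := hS.iterate_deriv 2
  rw [deriv_comp_affine_left hS]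
  have e1 : deriv (fun x => η⁻¹ * deriv S ((x - a) / η)) =
      fun x => η⁻¹ * (η⁻¹ * deriv (deriv S) ((x - a) / η)) := by
    funext x
    rw [deriv_const_mul_field, congrFun (deriv_comp_affine_left h1 a η) x]
  rw [e1]
  have e2 : deriv (fun x => η⁻¹ * (η⁻¹ * deriv (deriv S) ((x - a) / η))) =
      fun x => η⁻¹ * (η⁻¹ * (η⁻¹ * deriv (deriv (deriv S)) ((x - a) / η))) := by
    funext x
    rw [deriv_const_mul_field, deriv_const_mul_field, congrFun (deriv_comp_affine_left h2 a η) x]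
  rw [e2]
  funext x
  ring

/-- Third derivative through a decreasing affine map: `(S((b-·)/η))''' = -η⁻³ S'''((b-·)/η)`. [folklore] -/
theorem deriv3_comp_affine_right {S : ℝ → ℝ} (hS : ContDiff ℝ ∞ S) (b η : ℝ) :
    deriv (deriv (deriv fun x => S ((b - x) / η))) =
      fun x => -(η⁻¹ ^ 3) * deriv (deriv (deriv S)) ((b - x) / η) := by
  have h1 : ContDiff ℝ ∞ (deriv S) := hS.iterate_deriv 1
  have h2 : ContDiff ℝ ∞ (deriv (deriv S)) := hS.iterate_deriv 2
  rw [deriv_comp_affine_right hS]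
  have e1 : deriv (fun x => -η⁻¹ * deriv S ((b - x) / η)) =
      fun x => -η⁻¹ * (-η⁻¹ * deriv (deriv S) ((b - x) / η)) := by
    funext x
    rw [deriv_const_mul_field, congrFun (deriv_comp_affine_right h1 b η) x]
  rw [e1]
  have e2 : deriv (fun x => -η⁻¹ * (-η⁻¹ * deriv (deriv S) ((b - x) / η))) =
      fun x => -η⁻¹ * (-η⁻¹ * (-η⁻¹ * deriv (deriv (deriv S)) ((b - x) / η))) := by
    funext x
    rw [deriv_const_mul_field, deriv_const_mul_field, congrFun (deriv_comp_affine_right h2 b η) x]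
  rw [e2]
  funext x
  ring

/-- Third derivatives of two functions agreeing near a point agree at that point. [folklore] -/
theorem deriv3_eq_of_eventuallyEq {f g : ℝ → ℝ} {x : ℝ} (h : f =ᶠ[𝓝 x] g) :
    deriv (deriv (deriv f)) x = deriv (deriv (deriv g)) x :=
  ((h.deriv).deriv).deriv_eq

/-- **Convex ends of the plateau profile** (Ożański 2017, App. 8.1: "`fᵢ''' > 0` on
`(aᵢ, aᵢ+ε)` and `fᵢ''' < 0` on `(bᵢ-ε, bᵢ)` for some `ε ∈ (0,η)`"). If `η > 0` and
`a + 2η ≤ b`, there is `ε ∈ (0, η]` such that the third derivative of `plateauProfile a b η` is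
positive on `(a, a+ε)` and negative on `(b-ε, b)` (there the profile is `S((x-a)/η)`, resp.
`S((b-x)/η)`, and `S''' > 0` near `0⁺` by `exists_deriv3_smoothTransition_pos`).
[cite: Ozanski2017NSIInternal, Appendix 8.1 (proof of Lemma 21)] -/
theorem exists_deriv3_plateauProfile (hη : 0 < η) (hab : a + 2 * η ≤ b) :
    ∃ ε > 0, ε ≤ η ∧
      (∀ x ∈ Ioo a (a + ε), 0 < deriv (deriv (deriv (plateauProfile a b η))) x) ∧
      (∀ x ∈ Ioo (b - ε) b, deriv (deriv (deriv (plateauProfile a b η))) x < 0) := by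
  obtain ⟨t₀, ht₀, hS⟩ := exists_deriv3_smoothTransition_pos
  set ε : ℝ := η * min t₀ 1 with hε_def
  have hmin : 0 < min t₀ 1 := lt_min ht₀ one_pos
  have hε : 0 < ε := mul_pos hη hmin
  have hεη : ε ≤ η := by
    rw [hε_def]
    nlinarith [min_le_right t₀ 1]
  have hεt : ε ≤ η * t₀ := by
    rw [hε_def]
    exact mul_le_mul_of_nonneg_left (min_le_left _ _) hη.le
  refine ⟨ε, hε, hεη, fun x hx => ?_, fun x hx => ?_⟩
  · -- near `a`: the profile is `S((x-a)/η)` on the open set `{x < b - η}`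
    have hloc : plateauProfile a b η =ᶠ[𝓝 x] fun y => smoothTransition ((y - a) / η) := by
      have hx' : x < b - η := by linarith [hx.2]
      filter_upwards [Iio_mem_nhds hx'] with y hy using plateauProfile_eq_left hη hy.le
    rw [deriv3_eq_of_eventuallyEq hloc, deriv3_comp_affine_left smoothTransition.contDiff]
    have harg : (x - a) / η ∈ Ioo 0 t₀ := by
      refine ⟨div_pos (sub_pos.2 hx.1) hη, ?_⟩
      rw [div_lt_iff₀ hη]
      linarith [hx.2]
    have := hS _ harg
    positivity
  · -- near `b`: the profile is `S((b-x)/η)` on the open set `{a + η < x}`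
    have hloc : plateauProfile a b η =ᶠ[𝓝 x] fun y => smoothTransition ((b - y) / η) := by
      have hx' : a + η < x := by linarith [hx.1]
      filter_upwards [Ioi_mem_nhds hx'] with y hy using plateauProfile_eq_right hη hy.le
    rw [deriv3_eq_of_eventuallyEq hloc, deriv3_comp_affine_right smoothTransition.contDiff]
    have harg : (b - x) / η ∈ Ioo 0 t₀ := by
      refine ⟨div_pos (sub_pos.2 hx.2) hη, ?_⟩
      rw [div_lt_iff₀ hη]
      linarith [hx.1]
    have h1 := hS _ harg
    have h2 : 0 < η⁻¹ ^ 3 := by positivity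
    nlinarith [mul_pos h2 h1]

end Literature.Analysis.Calculus
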